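import Summits.Ventures.HSemireg.WedgeHankelOuterIndependence

/-!
# Venture HSemireg — THE VALUE: `dim Kr(Dm M, w_N q, k) = C(2M, k) − C(M, k) · rank H_k(q)` — on the `k`-forms of the sub-box of the first `M` pairs the kernel of th-7's class has
# codimension `C(M,k) · r_k`, `r_k = rank (q_{i+t})_{i ≤ k, t ≤ N−k}` the Hankel rank of the FULL box (th-7: codimension `C(N,k) · r_k` on all `k`-forms)

HONEST FRAMING. Part of the Lean index of the computation cell `pub-hsemireg` (seat p10 gen 22, Sunday typer «UNIFORM-IN-n»).
Finite-dimensional EXTERIOR ALGEBRA over a field ONLY: no variety, no cohomology theory, no sheaf, no Ext group, no semiregularity map;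
nothing here says that HC / HC_CM / HC_AV holds; no Literature fact is declared or used.  Custodian versions as in `WedgeHankelSiegelIdeal` (1/3); the dictionary (`w_N(q)` = the
class of the box on `N` pairs; `Dm M` = the generators of the first `M` pairs; `Kr(Dm M, ·, k)` = the kernel of the class on the `k`-forms of the sub-box; `H_k(q)` = the `k`-th
Hankel (catalecticant) matrix of the coefficient sequence) is QUOTED, never asserted.

WHAT IS IN THE TREE.  th-7's BLOCK HANKEL LAW `finrank_JRsum_w` (`WedgeHankelModel`: `dim Σ_a JR_k(Dm m, w_m ∘ q a) = C(m,k) · rank 𝓗^{(m)}_k[q]` for every array of sequences),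
the joint-range spaces `JR` / `JRsum` and block Hankel matrices `hank` (`WedgeHankelTuples`), `hankel1` and `hankelLaw_model` (th-7, the full box), the per-degree rank–nullity
`finrank_Kr_add_finrank_V` (`WedgeKunnethKernel`);
K37/K38 (this seat): `Kr K (Dm M) (w_N q) k = Hom(Dm M, k) ⊓ ⨅_{j : Fin (N−M+1)} Kr K (Dm M) (w_M(σ^j q)) k` (`Kr_w_eq_iInf_Kr_w_shift`).  THIS FILE (namespace
`Summit.Ventures.HSemireg.Wedge.HankelOuter`, continued; imports K38):
* §357 `card_Dm_eq_two_mul`, `finrank_Hom_In` (`dim Hom(D,k) = C(|D|,k)`), `finrank_inf_iInf_Kr_add_finrank_JR`: **JOINT RANK–NULLITY `dim (Hom(D,k) ⊓ ⨅_c Kr(D, f_c, k)) + dim JR_k(D, f) = C(|D|, k)`** for any finite tuple of classes `f`.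
* §358 `rank_hank_shifts_eq`: **the block Hankel matrix of the ROW of shifted sequences `(σ^j q)_{j ≤ N−M}` at level `M` has the rank of the full Hankel matrix `H_k(q)` at
  level `N`** (`k ≤ M ≤ N`: both have the column set `{(q_{i+t})_i : t ≤ N − k}`).
* §359 **`finrank_Kr_w_Dm_add`: `dim Kr K (Dm M) (w K N N q) k + C(M,k) · rank (hankel1 K N k q) = C(M+M, k)`** for ALL `M ≤ N`, `k`, `q`, every field (for `k > M` the
  Hankel term vanishes: every `k`-form of the sub-box dies); `finrank_Kr_w_Dm_eq` (the subtraction form); `finrank_Kr_w_Dm_top` (consistency at `M = N` with th-7's law: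
  `dim Kr K univ (w_N q) k + C(N,k) · rank H_k(q) = C(N+N, k)`); **`choose_mul_codim_eq`: `C(N,k) · (C(2M,k) − dim Kr_M) = C(M,k) · (C(2N,k) − dim Kr_N)`** — the Hankel
  matrix eliminated: the codimension of the kernel on the sub-box forms is the full codimension scaled by `C(M,k) / C(N,k)`.
This closes Gen 20/21 OPEN (c) for the sub-box of the FIRST `M` pairs; the transport to an arbitrary pair set `T`, `|T| = M` (K25: the dimension depends on `|T|` only, for
`Kr ⊓ Sp(pairs ⊆ T)`) needs the identification `Hom(Dm M, k) = Hom(univ, k) ⊓ Sp(pairs ⊆ [0, M))`, not typed here.  New names only.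
-/

open Module

namespace Summit.Ventures.HSemireg.Wedge.HankelOuter

open Summit.Ventures.HSemireg.Wedge Summit.Ventures.HSemireg.Wedge.Kunneth Summit.Ventures.HSemireg.Wedge.Hankel
  Summit.Ventures.HSemireg.Wedge.BasisFree Summit.Ventures.HSemireg.Wedge.HankelSiegel Summit.Ventures.HSemireg.Wedge.HankelSiegelIdeal
  Summit.Ventures.HSemireg.Wedge.KunnethKernel Summit.Ventures.HSemireg.Wedge.HankelFrameChange

variable (K : Type*) [Field K] {N : ℕ}

/-! ## §357. Joint rank–nullity for a tuple of classes -/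

/-- `|Dm M| = 2M` for `M ≤ N` (two fresh generators per pair, `Dm_succ`). -/
theorem card_Dm_eq_two_mul (M : ℕ) : M ≤ N → (Dm N M).card = 2 * M := by
  induction M with
  | zero => intro _; rw [Dm_zero, Finset.card_empty]
  | succ m ih =>
    intro hm
    have hmN : m < N := by omega
    rw [Dm_succ hmN, Finset.card_insert_of_notMem ?_, Finset.card_insert_of_notMem (yI_notMem hmN), ih hmN.le]
    · omega
    · rw [Finset.mem_insert, not_or]
      exact ⟨xI_ne_yI hmN, xI_notMem hmN⟩

/-- `dim Hom(D, k) = C(|D|, k)` in th-7's model (read off the per-degree rank–nullity `finrank_Kr_add_finrank_V` at the class `0`, whose kernel space is all of `Hom(D, k)`). -/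
theorem finrank_Hom_In (D : Finset (In N)) (k : ℕ) : finrank K ↥(Hom K (In N) D k) = D.card.choose k := by
  have h := finrank_Kr_add_finrank_V K D (0 : HT K (In N)) k
  have hKr : Kr K D (0 : HT K (In N)) k = Hom K (In N) D k := by
    ext θ
    rw [mem_Kr, mul_zero]
    exact ⟨fun h => h.1, fun h => ⟨h, rfl⟩⟩
  have hV : V K (In N) D (0 : HT K (In N)) k = ⊥ := by
    rw [V_eq_map, Submodule.eq_bot_iff]
    rintro _ ⟨θ, -, rfl⟩
    rw [LinearMap.mulRight_apply, mul_zero]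
  rw [hKr, hV, finrank_bot, add_zero] at h
  exact h

/-- **JOINT RANK–NULLITY: `dim (Hom(D, k) ⊓ ⨅_c Kr(D, f_c, k)) + dim JR_k(D, f) = C(|D|, k)`** — the joint kernel and the joint range of `θ ↦ (θ ∧ f_c)_c` on the degree-`k`
forms of the block `D` (any finite index type, any classes). -/
theorem finrank_inf_iInf_Kr_add_finrank_JR {β : Type} [Fintype β] (D : Finset (In N)) (k : ℕ) (f : β → HT K (In N)) :
    finrank K ↥(Hom K (In N) D k ⊓ ⨅ c, Kr K D (f c) k) + finrank K ↥(JR K (In N) D k f) = D.card.choose k := by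
  let g : Hom K (In N) D k →ₗ[K] (β → HT K (In N)) := (L K f) ∘ₗ (Hom K (In N) D k).subtype
  have hrange : LinearMap.range g = JR K (In N) D k f := by
    rw [LinearMap.range_comp, Submodule.range_subtype]
    rfl
  have hker : LinearMap.ker g = (Hom K (In N) D k ⊓ ⨅ c, Kr K D (f c) k).comap (Hom K (In N) D k).subtype := by
    ext θ
    rw [LinearMap.mem_ker, Submodule.mem_comap, Submodule.subtype_apply, Submodule.mem_inf, Submodule.mem_iInf, LinearMap.comp_apply, Submodule.subtype_apply]
    constructor
    · intro h
      refine ⟨θ.2, fun c => mem_Kr.mpr ⟨θ.2, ?_⟩⟩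
      have := congr_fun h c
      rwa [L_apply] at this
    · intro h
      funext c
      rw [L_apply]
      exact (mem_Kr.mp (h.2 c)).2
  have h := LinearMap.finrank_range_add_finrank_ker g
  rw [hrange, hker, (Submodule.comapSubtypeEquivOfLe (inf_le_left : Hom K (In N) D k ⊓ ⨅ c, Kr K D (f c) k ≤ Hom K (In N) D k)).finrank_eq, finrank_Hom_In] at h
  omega

/-! ## §358. The block Hankel matrix of the row of shifted sequences has the rank of the full Hankel matrix -/

/-- **`rank 𝓗^{(M)}_k[(σ^j q)_{j ≤ N−M}] = rank H^{(N)}_k(q)`** for `k ≤ M ≤ N`: the block matrix `[H^{(M)}_k(q) | H^{(M)}_k(σq) | ⋯ | H^{(M)}_k(σ^{N−M} q)]` and the full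
`(k+1) × (N+1−k)` Hankel matrix `(q_{i+t})` have the same columns `(q_{i+t})_{i ≤ k}`, `t = s + j ≤ N − k`. -/
theorem rank_hank_shifts_eq {M k : ℕ} (hM : M ≤ N) (hk : k ≤ M) (q : ℕ → K) :
    (hank K M k (fun (_ : Unit) (j : Fin (N - M + 1)) => (shift K)^[(j : ℕ)] q)).rank = (hankel1 K N k q).rank := by
  have hit : ∀ (l t : ℕ), (shift K)^[l] q t = q (t + l) := by
    intro l
    induction l with
    | zero => intro t; rfl
    | succ l ih => intro t; rw [Function.iterate_succ_apply', shift, ih]; ring_nf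
  apply le_antisymm
  · have h1 : hank K M k (fun (_ : Unit) (j : Fin (N - M + 1)) => (shift K)^[(j : ℕ)] q)
        = (hankel1 K N k q).submatrix (fun r : Unit × Fin (k + 1) => r.2)
            (fun s : Fin (N - M + 1) × Fin (M + 1 - k) => (⟨(s.2 : ℕ) + (s.1 : ℕ), by omega⟩ : Fin (N + 1 - k))) := by
      ext ⟨a, i⟩ ⟨j, s⟩
      simp only [hank, hank', hankel1, Matrix.submatrix_apply, Matrix.of_apply, hit]
      ring_nf
    rw [h1]
    exact Matrix.rank_submatrix_le _ _ _
  · have h2 : hankel1 K N k q = (hank K M k (fun (_ : Unit) (j : Fin (N - M + 1)) => (shift K)^[(j : ℕ)] q)).submatrix (fun i : Fin (k + 1) => ((), i))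
        (fun t : Fin (N + 1 - k) => ((⟨(t : ℕ) - (M - k), by omega⟩ : Fin (N - M + 1)), (⟨min (t : ℕ) (M - k), by omega⟩ : Fin (M + 1 - k)))) := by
      ext i t
      simp only [hank, hank', hankel1, Matrix.submatrix_apply, Matrix.of_apply, hit]
      congr 1
      omega
    rw [h2]
    exact Matrix.rank_submatrix_le _ _ _

/-! ## §359. The value of `dim Kr(Dm M, w_N q, k)` -/

/-- **THE VALUE: `dim Kr K (Dm M) (w K N N q) k + C(M, k) · rank (hankel1 K N k q) = C(M + M, k)`** for every `M ≤ N`, every degree `k`, every sequence `q` and every field — on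
the `k`-forms of the sub-box of the first `M` pairs the kernel of the class of the box has codimension `C(M,k) · r_k`, `r_k` the `k`-th Hankel rank of the FULL box (K38's
intersection formula, the joint rank–nullity, th-7's block Hankel law for the row `(σ^j q)_j`, and §358; for `k > M`, `C(M,k) = 0` and every `k`-form of the sub-box dies). -/
theorem finrank_Kr_w_Dm_add {M : ℕ} (hM : M ≤ N) (k : ℕ) (q : ℕ → K) :
    finrank K ↥(Kr K (Dm N M) (w K N N q) k) + M.choose k * (hankel1 K N k q).rank = (M + M).choose k := by
  classical
  have h1 := finrank_inf_iInf_Kr_add_finrank_JR K (Dm N M) k (fun j : Fin (N - M + 1) => w K N M ((shift K)^[(j : ℕ)] q))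
  rw [← Kr_w_eq_iInf_Kr_w_shift K hM k q, card_Dm_eq_two_mul M hM, two_mul] at h1
  have hJ : JRsum K (In N) (Dm N M) k (fun (_ : Unit) (j : Fin (N - M + 1)) => w K N M ((shift K)^[(j : ℕ)] q))
      = JR K (In N) (Dm N M) k (fun j : Fin (N - M + 1) => w K N M ((shift K)^[(j : ℕ)] q)) := by
    rw [JRsum]
    exact iSup_const
  have h2 := finrank_JRsum_w K (n := N) hM k Unit (Fin (N - M + 1)) (fun (_ : Unit) (j : Fin (N - M + 1)) => (shift K)^[(j : ℕ)] q)
  rw [hJ] at h2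
  rw [h2] at h1
  by_cases hk : k ≤ M
  · rw [rank_hank_shifts_eq K hM hk q] at h1
    exact h1
  · rw [Nat.choose_eq_zero_of_lt (by omega), zero_mul] at h1 ⊢
    simpa using h1

/-- subtraction form: **`dim Kr K (Dm M) (w K N N q) k = C(M + M, k) − C(M, k) · rank (hankel1 K N k q)`.** -/
theorem finrank_Kr_w_Dm_eq {M : ℕ} (hM : M ≤ N) (k : ℕ) (q : ℕ → K) :
    finrank K ↥(Kr K (Dm N M) (w K N N q) k) = (M + M).choose k - M.choose k * (hankel1 K N k q).rank := by
  have h := finrank_Kr_w_Dm_add K hM k q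
  omega

/-- for `k > M` every `k`-form of the sub-box of the first `M` pairs is killed by the class: **`dim Kr K (Dm M) (w K N N q) k = C(M + M, k)`.** -/
theorem finrank_Kr_w_Dm_of_lt {M : ℕ} (hM : M ≤ N) {k : ℕ} (hk : M < k) (q : ℕ → K) :
    finrank K ↥(Kr K (Dm N M) (w K N N q) k) = (M + M).choose k := by
  have h := finrank_Kr_w_Dm_add K hM k q
  rw [Nat.choose_eq_zero_of_lt hk, zero_mul, add_zero] at h
  exact h

/-- consistency at `M = N` (th-7's law for the full box, every degree): **`dim Kr K univ (w K N N q) k + C(N, k) · rank (hankel1 K N k q) = C(N + N, k)`.** -/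
theorem finrank_Kr_w_Dm_top (k : ℕ) (q : ℕ → K) :
    finrank K ↥(Kr K (Finset.univ : Finset (In N)) (w K N N q) k) + N.choose k * (hankel1 K N k q).rank = (N + N).choose k := by
  rw [← Dm_top]
  exact finrank_Kr_w_Dm_add K le_rfl k q

/-- **THE HANKEL MATRIX ELIMINATED: `C(N, k) · (C(M+M, k) − dim Kr K (Dm M) (w_N q) k) = C(M, k) · (C(N+N, k) − dim Kr K univ (w_N q) k)`** (`M ≤ N`) — the codimension of the
kernel on the sub-box forms is the full codimension scaled by `C(M,k) : C(N,k)`. -/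
theorem choose_mul_codim_eq {M : ℕ} (hM : M ≤ N) (k : ℕ) (q : ℕ → K) :
    N.choose k * ((M + M).choose k - finrank K ↥(Kr K (Dm N M) (w K N N q) k))
      = M.choose k * ((N + N).choose k - finrank K ↥(Kr K (Finset.univ : Finset (In N)) (w K N N q) k)) := by
  have h1 := finrank_Kr_w_Dm_add K hM k q
  have h2 := finrank_Kr_w_Dm_top K (N := N) k q
  have e1 : (M + M).choose k - finrank K ↥(Kr K (Dm N M) (w K N N q) k) = M.choose k * (hankel1 K N k q).rank := by omega
  have e2 : (N + N).choose k - finrank K ↥(Kr K (Finset.univ : Finset (In N)) (w K N N q) k) = N.choose k * (hankel1 K N k q).rank := by omega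
  rw [e1, e2]
  ring

end Summit.Ventures.HSemireg.Wedge.HankelOuter
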